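import Summits.HodgeConjecture.HodgeConjecture.Theorems.A3Liu418S34ClauseOneOfGS
import Summits.HodgeConjecture.HodgeConjecture.Theorems.A3Liu418S34ClauseOneOfCurveRecords
import Summits.HodgeConjecture.HodgeConjecture.Theorems.A3Liu418S34ClauseOnePinning
import Summits.HodgeConjecture.CorCM.HypLiu418.A3Liu418GSFrobenius
import Summits.HodgeConjecture.CorCM.HypLiu418.A3Liu418Items
import Literature.AlgebraicGeometry.ShimuraVarieties.UnitaryShimuraCurveCanonicalModelExists
import Literature.NumberTheory.Automorphic.Liu2021.AppendixC.SeesawSourceTransport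
import HarnessLib

/-!
# GS-8 — [Liu2021, Thm. 4.15 proof p. 51] the seesaw input `S34SomeSource` at the face FROM the GS unitary Shimura curve source
# (cell hodgecm-mathlib, E-GS; crux `stub_S34` of the 24832 registry `Cruxes/HLiu418/Lines/a3_liu418.lean`)

PROOF FILE (two theorems; no definition, no named fact, no instance, no `sorry`).  At every face `(hDel, F, ι₁, V, a, Φ, ν, ℓ, ι′)` with
`6 ≤ [F:ℚ]`, GIVEN the three named facts of the E-GS programme as HYPOTHESES — GS-3 `exists_recordSystemGS` (canonical model of the compact
unitary Shimura CURVE with its Hecke translates, embeddings and level quotients; [Deligne1979ShimuraVarieties] Thm. 2.7.20 / Cor. 2.7.21,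
[Milne2005ShimuraVarieties] Thm. 13.6–13.7), III-8′ `MR92Prop6Source` ([MurtyRamakrishnan1992] Prop. 6 through [Liu2021] fn. 9) and GS-6
`frobeniusActsByGS` ([Liu2021] App. D Thm. D.6 (1) + Rem. D.5) — and the printed-citation witness `hDel`, the predicate
`S34SomeSource (CV …) (UV …) ℓ X ι′ ν hν (TV …) Pin` of ★ `AppendixC/SeesawSource` holds for every étale Hecke datum `X` induced by the
Albanese translates and every pin predicate `Pin` fed by the registry's constructor `mkPin`:
* (H1) `s34SomeSource_fourLe_of_GS` — at the EXPLICIT carrier `C₄ := sec42DataOfFourLe …`: clause (1) (a seesaw source DETECTING the given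
  non-zero `f` of the Hom-space) is F6 ★ `exists_seesawSourceGS_etPull_comp_ne_zero` (the GS source `seesawSourceGS` of ★ (b)
  `A3Liu418GSSeesawSource`, fed by F3b ★ `nonempty_bettiPinning_conj_fourLe_of_lemma24Proj`), clause (2) (Frobenius acts by
  `(ι′ μ^{alg}(ϖ_v))⁻¹`) is GS-6 through ★ `frobeniusActsBy_seesawSourceGS_iff` (`Iff.rfl`);
* (H2) `s34SomeSource_CV_of_GS` — at the face's TOTAL carrier `(CV, UV, TV)` (the registry's currency), by F4 ★ `S34SomeSource.forall_transport`
  along ★ `sec42DataOf_eq_of_four_le` (`dif_pos`), ★ `UniformOmega.heq_mk_of_eq`, ★ `sec42DataOf_heckeTranslates_heq` and `HEq.rfl` for `Pin`.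
HC_CM is proved only modulo the 7 printed citations until rung 0 closes; nothing of [Liu2021] App. D is asserted here (GS-6 is a binder).
Edition 2 (HB, A-p18 g8) + v20 heads (A-p09 g10).  HB (proof bodies only; every (H1)/(H2) statement and docstring byte-identical to ★ p690754): both theorems at Lean's DEFAULT budgets (H1 measured
2.57 M → 133 k heartbeats, H2 44 k; the two 8 000 000 / two `synthInstance` 400 000 lines removed; farm wall 62 s → 29 s) — H1's two `∃`-facts are
bound (`have`) before `obtain` destructures them: on an application `rcases` generalises the term over the unfolded `S34SomeSource` goal (1.2 M a site).
v20 heads (APPENDED `section HeadsV20`, registry v20 of `stmt-HodgeConjecture-24832`): (H1′) `s34SomeSource_fourLe_of_GS'` / (H2′)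
`s34SomeSource_CV_of_GS'` = (H1)/(H2) with the binder `hGS3` (GS-3 `exists_recordSystemGS`) DROPPED — clause (1) comes from the v20 head
`exists_seesawSourceGS_etPull_comp_ne_zero'` of the sibling leaf ★ `Theorems.A3Liu418S34ClauseOneOfCurveRecords` (road (ii) «embedded-curve
descent»: the curve record systems from ★ GS-3″ at the cone's own surface record); same proof shape, DEFAULT budgets.

References: [Liu2021] Y. Liu, *Fourier–Jacobi cycles and arithmetic relative trace formula*, Thm. 4.15 proof p. 51 (FJcycle.tex l. 2185–2213)
with fn. 9; App. D Thm. D.6 (1) p. 132, Rem. D.5 p. 131; §4.2 l. 2053–2081.  [Deligne1979ShimuraVarieties] Thm. 2.7.20, Cor. 2.7.21.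
[Milne2005ShimuraVarieties] Thm. 13.6 p. 118, Thm. 13.7 p. 119.  [MurtyRamakrishnan1992] Prop. 6.
-/

set_option autoImplicit false

noncomputable section

namespace Summit.HodgeConjecture.CorCM.Lines.A3Liu418

open scoped TensorProduct Matrix NumberField
open NumberField
open Summit.HodgeConjecture.CorCM.Model
open Summit.HodgeConjecture.CorCM.Model.HComp Summit.HodgeConjecture.CorCM.HComp
open Literature.AlgebraicGeometry.Motives (CMType)
open Literature.AlgebraicGeometry.ShimuraVarieties.UnitaryCanonicalModel
open Literature.NumberTheory.Automorphic Literature.NumberTheory.Automorphic.UnitaryGroup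
open Literature.NumberTheory.Automorphic.Liu2021 Literature.NumberTheory.Automorphic.Liu2021.AppendixC

section Heads

/-- **(H1) `S34SomeSource` FROM THE GS SEESAW SOURCE, at the EXPLICIT carrier `C₄ := sec42DataOfFourLe …` with translates `T₄` and the
face's uniform Weil model re-typed field by field (`U₄ := {UV with}`; F4 ★ `UniformOmega.heq_mk_of_eq`).**  For every induced étale Hecke datum
`X` of `C₄`: unfold `S34SomeSource`; clause (1) is F6 `exists_seesawSourceGS_etPull_comp_ne_zero` (fed by F3b ★
`nonempty_bettiPinning_conj_fourLe_of_lemma24Proj` for the Betti pinning along `conj ∘ ι₁`, with the registry's `mkPin` feeder evaluated at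
`eG := refl`, `φ_pin := rfl`), clause (2) is the named fact GS-6 `frobeniusActsByGS` through ★ `frobeniusActsBy_seesawSourceGS_iff` (`Iff.rfl`).
HC_CM is NOT proved; `hGS3`, `hMR`, `hGS6`, `hDel` are hypotheses. [cite: Liu2021, Thm. 4.15 proof p. 51 (FJcycle.tex l. 2185–2213) with fn. 9; App. D Thm. D.6 (1) p. 132, Rem. D.5 p. 131]
[cite: Deligne1979ShimuraVarieties, Thm. 2.7.20, Cor. 2.7.21] [cite: Milne2005ShimuraVarieties, Thm. 13.6 p. 118, Thm. 13.7 p. 119] -/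
theorem s34SomeSource_fourLe_of_GS
    (hGS3 : Literature.AlgebraicGeometry.ShimuraVarieties.UnitaryCanonicalModel.exists_recordSystemGS)
    (hMR : ∀ {X : Literature.AlgebraicGeometry.Motives.SchemeOver ℂ}
      (D : Literature.AlgebraicGeometry.ShimuraVarieties.UnitaryBallUniformisationDatum 2 X), D.MR92Prop6Source)
    (hGS6 : frobeniusActsByGS)
    (hDel : Literature.AlgebraicGeometry.ShimuraVarieties.UnitaryCanonicalModel.canonicalModel_exists_printed)
    (F : HodgeCM.CMField) [IsGalois ℚ F] (h6 : 6 ≤ Module.finrank ℚ F) {ι₁ : F →+* ℂ} (V : HodgeCM.HermSpace3 F ι₁)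
    (a : HodgeCM.Model.LiuIndex.RealScalar F) (Φ : CMType F) (hΦ : ι₁ ∈ Φ.1)
    (ν : Literature.NumberTheory.Automorphic.IdeleClassGroup (F : Type) →ₜ* Circle)
    (hν : IdeleClassGroup.IsConjugateSymplectic (F : Type) ν) (hw : IdeleClassGroup.HasWeight (F : Type) ν 1)
    (ℓ : ℕ) [Fact ℓ.Prime] (ι' : ℂ ≃+* AlgebraicClosure ℚ_[ℓ])
    (Pin : ∀ {P5ₛ : PropC5Data ↥(maximalRealSubfield (F : Type)) (F : Type)} {isoₛ : ℕ → Prop} (Cₛ : Sec42Data P5ₛ isoₛ),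
      (Cₛ.G →* (CV hDel F V Φ).G) → Prop)
    (mkPin : ∀ (Jstar : Matrix (Fin 2) (Fin 2) (F : Type)) (Jperp : Matrix (Fin 1) (Fin 1) (F : Type)) (B : GL (Fin 3) (F : Type))
      (hB : formCongr ((IsCMField.complexConj (F : Type) : (F : Type) ≃ₐ[↥(maximalRealSubfield (F : Type))] (F : Type)) :
          (F : Type) →+* (F : Type)) B ((1 : (F : Type)) • HodgeCM.HermSpace3.Hm V) = finSum 2 1 Jstar Jperp)
      (_ : ∀ τ : (F : Type) →+* ℂ, 0 < (τ (Jperp 0 0)).re)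
      {K₀ : C5.OpenCompactSubgroup ↥(finAdelic ↥(maximalRealSubfield (F : Type)) (F : Type) (IsCMField.complexConj (F : Type)) 2 Jstar)}
      (S : RecordSystemGS (F : Type) Jstar ι₁ K₀)
      (eG : (sec42DataGS (F := ⟨HodgeCM.CMField.K F⟩) S (le_trans (Nat.le_of_ble_eq_true rfl) h6)
          (Model.isoOf ⟨HodgeCM.CMField.K F⟩ ι₁ ⟨HodgeCM.HermSpace3.Hm V, HodgeCM.HermSpace3.isHermitian V,
            HodgeCM.HermSpace3.signature_ι₁ V, HodgeCM.HermSpace3.posDef_of_ne V⟩ Φ)).G ≃ₜ*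
        ↥(finAdelic ↥(maximalRealSubfield (F : Type)) (F : Type) (IsCMField.complexConj (F : Type)) 2 Jstar))
      (_ : ∀ u, φGS (F : Type) Jstar Jperp (HodgeCM.HermSpace3.Hm V) B one_ne_zero hB (eG.symm u) =
        finAdelicCongr ↥(maximalRealSubfield (F : Type)) (F : Type) (IsCMField.complexConj (F : Type)) B one_ne_zero hB
          (finAdelicBlockDiag ↥(maximalRealSubfield (F : Type)) (F : Type) (IsCMField.complexConj (F : Type)) 2 1 Jstar Jperp (u, 1))),
      Pin (sec42DataGS (F := ⟨HodgeCM.CMField.K F⟩) S (le_trans (Nat.le_of_ble_eq_true rfl) h6)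
          (Model.isoOf ⟨HodgeCM.CMField.K F⟩ ι₁ ⟨HodgeCM.HermSpace3.Hm V, HodgeCM.HermSpace3.isHermitian V,
            HodgeCM.HermSpace3.signature_ι₁ V, HodgeCM.HermSpace3.posDef_of_ne V⟩ Φ))
        (φGS (F : Type) Jstar Jperp (HodgeCM.HermSpace3.Hm V) B one_ne_zero hB)) :
    ∀ X : (sec42DataOfFourLe (Summit.HodgeConjecture.CorCM.DelRec.exists_recordSystem_of_printed hDel)
        (⟨HodgeCM.HermSpace3.Hm V, HodgeCM.HermSpace3.isHermitian V, HodgeCM.HermSpace3.signature_ι₁ V, HodgeCM.HermSpace3.posDef_of_ne V⟩ :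
          HermSpace3 (⟨HodgeCM.CMField.K F⟩ : CMField) ι₁) Φ (le_trans (Nat.le_of_ble_eq_true rfl) h6)
        (Model.isoOf ⟨HodgeCM.CMField.K F⟩ ι₁ ⟨HodgeCM.HermSpace3.Hm V, HodgeCM.HermSpace3.isHermitian V,
          HodgeCM.HermSpace3.signature_ι₁ V, HodgeCM.HermSpace3.posDef_of_ne V⟩ Φ)).EtaleHeckeDatum ℓ,
      X.IsInducedBy (sec42DataOfFourLe_heckeTranslates heckeTranslate_definedOver_holds
          (Summit.HodgeConjecture.CorCM.DelRec.exists_recordSystem_of_printed hDel)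
          (⟨HodgeCM.HermSpace3.Hm V, HodgeCM.HermSpace3.isHermitian V, HodgeCM.HermSpace3.signature_ι₁ V, HodgeCM.HermSpace3.posDef_of_ne V⟩ :
            HermSpace3 (⟨HodgeCM.CMField.K F⟩ : CMField) ι₁) Φ (le_trans (Nat.le_of_ble_eq_true rfl) h6)
          (Model.isoOf ⟨HodgeCM.CMField.K F⟩ ι₁ ⟨HodgeCM.HermSpace3.Hm V, HodgeCM.HermSpace3.isHermitian V,
            HodgeCM.HermSpace3.signature_ι₁ V, HodgeCM.HermSpace3.posDef_of_ne V⟩ Φ)) →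
      S34SomeSource
        (sec42DataOfFourLe (Summit.HodgeConjecture.CorCM.DelRec.exists_recordSystem_of_printed hDel)
          (⟨HodgeCM.HermSpace3.Hm V, HodgeCM.HermSpace3.isHermitian V, HodgeCM.HermSpace3.signature_ι₁ V, HodgeCM.HermSpace3.posDef_of_ne V⟩ :
            HermSpace3 (⟨HodgeCM.CMField.K F⟩ : CMField) ι₁) Φ (le_trans (Nat.le_of_ble_eq_true rfl) h6)
          (Model.isoOf ⟨HodgeCM.CMField.K F⟩ ι₁ ⟨HodgeCM.HermSpace3.Hm V, HodgeCM.HermSpace3.isHermitian V,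
            HodgeCM.HermSpace3.signature_ι₁ V, HodgeCM.HermSpace3.posDef_of_ne V⟩ Φ))
        ({ Eps := (UV hDel F V a Φ).Eps, epsOf := (UV hDel F V a Φ).epsOf, Chi := (UV hDel F V a Φ).Chi,
           omega := (UV hDel F V a Φ).omega, rho := (UV hDel F V a Φ).rho } :
          UniformOmega (sec42DataOfFourLe (Summit.HodgeConjecture.CorCM.DelRec.exists_recordSystem_of_printed hDel)
            (⟨HodgeCM.HermSpace3.Hm V, HodgeCM.HermSpace3.isHermitian V, HodgeCM.HermSpace3.signature_ι₁ V, HodgeCM.HermSpace3.posDef_of_ne V⟩ :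
              HermSpace3 (⟨HodgeCM.CMField.K F⟩ : CMField) ι₁) Φ (le_trans (Nat.le_of_ble_eq_true rfl) h6)
            (Model.isoOf ⟨HodgeCM.CMField.K F⟩ ι₁ ⟨HodgeCM.HermSpace3.Hm V, HodgeCM.HermSpace3.isHermitian V,
              HodgeCM.HermSpace3.signature_ι₁ V, HodgeCM.HermSpace3.posDef_of_ne V⟩ Φ)))
        ℓ X ι' ν hν
        (sec42DataOfFourLe_heckeTranslates heckeTranslate_definedOver_holds
          (Summit.HodgeConjecture.CorCM.DelRec.exists_recordSystem_of_printed hDel)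
          (⟨HodgeCM.HermSpace3.Hm V, HodgeCM.HermSpace3.isHermitian V, HodgeCM.HermSpace3.signature_ι₁ V, HodgeCM.HermSpace3.posDef_of_ne V⟩ :
            HermSpace3 (⟨HodgeCM.CMField.K F⟩ : CMField) ι₁) Φ (le_trans (Nat.le_of_ble_eq_true rfl) h6)
          (Model.isoOf ⟨HodgeCM.CMField.K F⟩ ι₁ ⟨HodgeCM.HermSpace3.Hm V, HodgeCM.HermSpace3.isHermitian V,
            HodgeCM.HermSpace3.signature_ι₁ V, HodgeCM.HermSpace3.posDef_of_ne V⟩ Φ))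
        Pin := by
  intro X hX _h3 _hw1 ε hε χ f hf hf0
  -- the face's Betti pinning along `conj ∘ ι₁` at the explicit carrier (F3b ★)
  have hBpin := nonempty_bettiPinning_conj_fourLe_of_lemma24Proj hDel F h6 V a Φ
  obtain ⟨Bpin⟩ := hBpin
  -- CLAUSE (1): the GS seesaw source detecting `f` (F6), with the registry's pin feeder evaluated at `eG := refl`, `φ_pin := rfl`
  have hsrc := exists_seesawSourceGS_etPull_comp_ne_zero hGS3 hMR heckeTranslate_definedOver_holds
      (Summit.HodgeConjecture.CorCM.DelRec.exists_recordSystem_of_printed hDel)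
      (⟨HodgeCM.HermSpace3.Hm V, HodgeCM.HermSpace3.isHermitian V, HodgeCM.HermSpace3.signature_ι₁ V, HodgeCM.HermSpace3.posDef_of_ne V⟩ :
        HermSpace3 (⟨HodgeCM.CMField.K F⟩ : CMField) ι₁) Φ (le_trans (Nat.le_of_ble_eq_true rfl) h6)
      (Model.isoOf ⟨HodgeCM.CMField.K F⟩ ι₁ ⟨HodgeCM.HermSpace3.Hm V, HodgeCM.HermSpace3.isHermitian V,
        HodgeCM.HermSpace3.signature_ι₁ V, HodgeCM.HermSpace3.posDef_of_ne V⟩ Φ)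
      (Model.isoOf ⟨HodgeCM.CMField.K F⟩ ι₁ ⟨HodgeCM.HermSpace3.Hm V, HodgeCM.HermSpace3.isHermitian V,
        HodgeCM.HermSpace3.signature_ι₁ V, HodgeCM.HermSpace3.posDef_of_ne V⟩ Φ)
      X ι' hX Bpin ((UV hDel F V a Φ).rho ν hν ε χ) f hf hf0 Pin
      (fun Jstar Jperp B hB hpos {K₀} S => mkPin Jstar Jperp B hB hpos S (ContinuousMulEquiv.refl _) (fun _ => rfl))
  obtain ⟨Jstar, Jperp, B, hB, hpos, K₀, S, hU7ₛ, hEmb, hLQ, hK₀, hne⟩ := hsrc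
  refine ⟨_, hne, ?_⟩
  -- CLAUSE (2): the named fact GS-6 at the curve's own §4.2 datum (`frobeniusActsBy_seesawSourceGS_iff` is `Iff.rfl`)
  rw [frobeniusActsBy_seesawSourceGS_iff]
  exact hGS6 hDel F V a Φ hΦ ν hν hw ℓ ι' Jstar K₀ S hU7ₛ hLQ _ _ Jperp B 1 one_ne_zero hB
    (by rw [map_one, Complex.one_re]; exact one_pos) (by rw [map_one, Complex.one_im]) ε hε χ

/-- **(H2) `S34SomeSource` AT THE FACE FROM THE GS SEESAW SOURCE — the GS-8 head the v18 registry's `stub_S34` fill consumes** (signature of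
record, A-p18 8d87338b): (H1) `s34SomeSource_fourLe_of_GS` transported ONCE from the explicit carrier `(C₄, U₄, T₄)` to the face's total carrier
`(CV, UV, TV)` by F4 ★ `S34SomeSource.forall_transport` along ★ `sec42DataOf_eq_of_four_le` (`dif_pos`), ★ `UniformOmega.heq_mk_of_eq`,
★ `sec42DataOf_heckeTranslates_heq`, `HEq.rfl` for `Pin` (`Sec42Data.G` is `P5.G` by `rfl`).  HC_CM is NOT proved; `hGS3` ([Deligne1979ShimuraVarieties]
2.7.20–21 / [Milne2005ShimuraVarieties] 13.6–13.7 for the compact unitary curve), `hMR` (III-8′), `hGS6` ([Liu2021] Thm. D.6 (1)), `hDel` are hypotheses.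
[cite: Liu2021, Thm. 4.15 proof p. 51 (FJcycle.tex l. 2185–2213) with fn. 9; App. D Thm. D.6 (1) p. 132, Rem. D.5 p. 131; §4.2 l. 2053–2081]
[cite: Deligne1979ShimuraVarieties, Thm. 2.7.20, Cor. 2.7.21] [cite: Milne2005ShimuraVarieties, Thm. 13.6 p. 118, Thm. 13.7 p. 119] -/
theorem s34SomeSource_CV_of_GS
    (hGS3 : Literature.AlgebraicGeometry.ShimuraVarieties.UnitaryCanonicalModel.exists_recordSystemGS)
    (hMR : ∀ {X : Literature.AlgebraicGeometry.Motives.SchemeOver ℂ}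
      (D : Literature.AlgebraicGeometry.ShimuraVarieties.UnitaryBallUniformisationDatum 2 X), D.MR92Prop6Source)
    (hGS6 : frobeniusActsByGS)
    (hDel : Literature.AlgebraicGeometry.ShimuraVarieties.UnitaryCanonicalModel.canonicalModel_exists_printed)
    (F : HodgeCM.CMField) [IsGalois ℚ F] (h6 : 6 ≤ Module.finrank ℚ F) {ι₁ : F →+* ℂ} (V : HodgeCM.HermSpace3 F ι₁)
    (a : HodgeCM.Model.LiuIndex.RealScalar F) (Φ : CMType F) (hΦ : ι₁ ∈ Φ.1)
    (ν : Literature.NumberTheory.Automorphic.IdeleClassGroup (F : Type) →ₜ* Circle)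
    (hν : IdeleClassGroup.IsConjugateSymplectic (F : Type) ν) (hw : IdeleClassGroup.HasWeight (F : Type) ν 1)
    (ℓ : ℕ) [Fact ℓ.Prime] (X : (CV hDel F V Φ).EtaleHeckeDatum ℓ) (ι' : ℂ ≃+* AlgebraicClosure ℚ_[ℓ])
    (hX : X.IsInducedBy (TV hDel F h6 V Φ))
    (Pin : ∀ {P5ₛ : PropC5Data ↥(maximalRealSubfield (F : Type)) (F : Type)} {isoₛ : ℕ → Prop} (Cₛ : Sec42Data P5ₛ isoₛ),
      (Cₛ.G →* (CV hDel F V Φ).G) → Prop)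
    (mkPin : ∀ (Jstar : Matrix (Fin 2) (Fin 2) (F : Type)) (Jperp : Matrix (Fin 1) (Fin 1) (F : Type)) (B : GL (Fin 3) (F : Type))
      (hB : formCongr ((IsCMField.complexConj (F : Type) : (F : Type) ≃ₐ[↥(maximalRealSubfield (F : Type))] (F : Type)) :
          (F : Type) →+* (F : Type)) B ((1 : (F : Type)) • HodgeCM.HermSpace3.Hm V) = finSum 2 1 Jstar Jperp)
      (_ : ∀ τ : (F : Type) →+* ℂ, 0 < (τ (Jperp 0 0)).re)
      {K₀ : C5.OpenCompactSubgroup ↥(finAdelic ↥(maximalRealSubfield (F : Type)) (F : Type) (IsCMField.complexConj (F : Type)) 2 Jstar)}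
      (S : RecordSystemGS (F : Type) Jstar ι₁ K₀)
      (eG : (sec42DataGS (F := ⟨HodgeCM.CMField.K F⟩) S (le_trans (Nat.le_of_ble_eq_true rfl) h6)
          (Model.isoOf ⟨HodgeCM.CMField.K F⟩ ι₁ ⟨HodgeCM.HermSpace3.Hm V, HodgeCM.HermSpace3.isHermitian V,
            HodgeCM.HermSpace3.signature_ι₁ V, HodgeCM.HermSpace3.posDef_of_ne V⟩ Φ)).G ≃ₜ*
        ↥(finAdelic ↥(maximalRealSubfield (F : Type)) (F : Type) (IsCMField.complexConj (F : Type)) 2 Jstar))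
      (_ : ∀ u, φGS (F : Type) Jstar Jperp (HodgeCM.HermSpace3.Hm V) B one_ne_zero hB (eG.symm u) =
        finAdelicCongr ↥(maximalRealSubfield (F : Type)) (F : Type) (IsCMField.complexConj (F : Type)) B one_ne_zero hB
          (finAdelicBlockDiag ↥(maximalRealSubfield (F : Type)) (F : Type) (IsCMField.complexConj (F : Type)) 2 1 Jstar Jperp (u, 1))),
      Pin (sec42DataGS (F := ⟨HodgeCM.CMField.K F⟩) S (le_trans (Nat.le_of_ble_eq_true rfl) h6)
          (Model.isoOf ⟨HodgeCM.CMField.K F⟩ ι₁ ⟨HodgeCM.HermSpace3.Hm V, HodgeCM.HermSpace3.isHermitian V,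
            HodgeCM.HermSpace3.signature_ι₁ V, HodgeCM.HermSpace3.posDef_of_ne V⟩ Φ))
        (φGS (F : Type) Jstar Jperp (HodgeCM.HermSpace3.Hm V) B one_ne_zero hB)) :
    S34SomeSource (CV hDel F V Φ) (UV hDel F V a Φ) ℓ X ι' ν hν (TV hDel F h6 V Φ) Pin := by
  refine S34SomeSource.forall_transport
    (sec42DataOf_eq_of_four_le (Summit.HodgeConjecture.CorCM.DelRec.exists_recordSystem_of_printed hDel)
      (⟨HodgeCM.HermSpace3.Hm V, HodgeCM.HermSpace3.isHermitian V, HodgeCM.HermSpace3.signature_ι₁ V, HodgeCM.HermSpace3.posDef_of_ne V⟩ :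
        HermSpace3 (⟨HodgeCM.CMField.K F⟩ : CMField) ι₁) Φ Model.isoOf (le_trans (Nat.le_of_ble_eq_true rfl) h6)).symm
    (UniformOmega.heq_mk_of_eq
      (sec42DataOf_eq_of_four_le (Summit.HodgeConjecture.CorCM.DelRec.exists_recordSystem_of_printed hDel)
        (⟨HodgeCM.HermSpace3.Hm V, HodgeCM.HermSpace3.isHermitian V, HodgeCM.HermSpace3.signature_ι₁ V, HodgeCM.HermSpace3.posDef_of_ne V⟩ :
          HermSpace3 (⟨HodgeCM.CMField.K F⟩ : CMField) ι₁) Φ Model.isoOf (le_trans (Nat.le_of_ble_eq_true rfl) h6))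
      (UV hDel F V a Φ))
    ι' ν hν
    (sec42DataOf_heckeTranslates_heq heckeTranslate_definedOver_holds
      (Summit.HodgeConjecture.CorCM.DelRec.exists_recordSystem_of_printed hDel)
      (⟨HodgeCM.HermSpace3.Hm V, HodgeCM.HermSpace3.isHermitian V, HodgeCM.HermSpace3.signature_ι₁ V, HodgeCM.HermSpace3.posDef_of_ne V⟩ :
        HermSpace3 (⟨HodgeCM.CMField.K F⟩ : CMField) ι₁) Φ Model.isoOf (le_trans (Nat.le_of_ble_eq_true rfl) h6)).symm
    (Pin := Pin) HEq.rfl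
    (s34SomeSource_fourLe_of_GS hGS3 hMR hGS6 hDel F h6 V a Φ hΦ ν hν hw ℓ ι' Pin mkPin) X hX

end Heads

/-! ## §v20 (APPEND-ONLY edition, registry v20 of `stmt-HodgeConjecture-24832`): the heads WITHOUT `hGS3`

GS-3 (`exists_recordSystemGS`) is retired by road (ii) «embedded-curve descent»: the v20 sibling leaf
★ `Theorems.A3Liu418S34ClauseOneOfCurveRecords` supplies the primed clause-(1) head `exists_seesawSourceGS_etPull_comp_ne_zero'` (= ★ `exists_seesawSourceGS_etPull_comp_ne_zero` with the binder
`hGS3` DROPPED and no new binder: the curve record systems come from ★ GS-3″ `exists_recordSystemGS_of_recordSystem` at the cone's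
own surface record, ★ (F-A) and ★ F-INJ).  The two theorems below are (H1)/(H2) VERBATIM with `hGS3` dropped and that head called;
the v18/v19 heads above stay byte-identical until the registry's `stub_S34` fill points here (cleanup edition later).
HC_CM is proved only modulo the 7 printed citations until rung 0 closes. -/

section HeadsV20

/-- **(H1) `S34SomeSource` FROM THE GS SEESAW SOURCE, at the EXPLICIT carrier `C₄ := sec42DataOfFourLe …` with translates `T₄` and the
face's uniform Weil model re-typed field by field (`U₄ := {UV with}`; F4 ★ `UniformOmega.heq_mk_of_eq`).**  For every induced étale Hecke datum
`X` of `C₄`: unfold `S34SomeSource`; clause (1) is the v20 head `exists_seesawSourceGS_etPull_comp_ne_zero'` of ★ `A3Liu418S34ClauseOneOfCurveRecords` (fed by F3b ★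
`nonempty_bettiPinning_conj_fourLe_of_lemma24Proj` for the Betti pinning along `conj ∘ ι₁`, with the registry's `mkPin` feeder evaluated at
`eG := refl`, `φ_pin := rfl`), clause (2) is the named fact GS-6 `frobeniusActsByGS` through ★ `frobeniusActsBy_seesawSourceGS_iff` (`Iff.rfl`).
HC_CM is NOT proved; `hMR`, `hGS6`, `hDel` are hypotheses (v20: `hGS3` dropped — GS-3 retired by road (ii)). [cite: Liu2021, Thm. 4.15 proof p. 51 (FJcycle.tex l. 2185–2213) with fn. 9; App. D Thm. D.6 (1) p. 132, Rem. D.5 p. 131]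
[cite: Deligne1979ShimuraVarieties, Thm. 2.7.20, Cor. 2.7.21] [cite: Milne2005ShimuraVarieties, Thm. 13.6 p. 118, Thm. 13.7 p. 119] -/
theorem s34SomeSource_fourLe_of_GS'
    (hMR : ∀ {X : Literature.AlgebraicGeometry.Motives.SchemeOver ℂ}
      (D : Literature.AlgebraicGeometry.ShimuraVarieties.UnitaryBallUniformisationDatum 2 X), D.MR92Prop6Source)
    (hGS6 : frobeniusActsByGS)
    (hDel : Literature.AlgebraicGeometry.ShimuraVarieties.UnitaryCanonicalModel.canonicalModel_exists_printed)
    (F : HodgeCM.CMField) [IsGalois ℚ F] (h6 : 6 ≤ Module.finrank ℚ F) {ι₁ : F →+* ℂ} (V : HodgeCM.HermSpace3 F ι₁)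
    (a : HodgeCM.Model.LiuIndex.RealScalar F) (Φ : CMType F) (hΦ : ι₁ ∈ Φ.1)
    (ν : Literature.NumberTheory.Automorphic.IdeleClassGroup (F : Type) →ₜ* Circle)
    (hν : IdeleClassGroup.IsConjugateSymplectic (F : Type) ν) (hw : IdeleClassGroup.HasWeight (F : Type) ν 1)
    (ℓ : ℕ) [Fact ℓ.Prime] (ι' : ℂ ≃+* AlgebraicClosure ℚ_[ℓ])
    (Pin : ∀ {P5ₛ : PropC5Data ↥(maximalRealSubfield (F : Type)) (F : Type)} {isoₛ : ℕ → Prop} (Cₛ : Sec42Data P5ₛ isoₛ),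
      (Cₛ.G →* (CV hDel F V Φ).G) → Prop)
    (mkPin : ∀ (Jstar : Matrix (Fin 2) (Fin 2) (F : Type)) (Jperp : Matrix (Fin 1) (Fin 1) (F : Type)) (B : GL (Fin 3) (F : Type))
      (hB : formCongr ((IsCMField.complexConj (F : Type) : (F : Type) ≃ₐ[↥(maximalRealSubfield (F : Type))] (F : Type)) :
          (F : Type) →+* (F : Type)) B ((1 : (F : Type)) • HodgeCM.HermSpace3.Hm V) = finSum 2 1 Jstar Jperp)
      (_ : ∀ τ : (F : Type) →+* ℂ, 0 < (τ (Jperp 0 0)).re)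
      {K₀ : C5.OpenCompactSubgroup ↥(finAdelic ↥(maximalRealSubfield (F : Type)) (F : Type) (IsCMField.complexConj (F : Type)) 2 Jstar)}
      (S : RecordSystemGS (F : Type) Jstar ι₁ K₀)
      (eG : (sec42DataGS (F := ⟨HodgeCM.CMField.K F⟩) S (le_trans (Nat.le_of_ble_eq_true rfl) h6)
          (Model.isoOf ⟨HodgeCM.CMField.K F⟩ ι₁ ⟨HodgeCM.HermSpace3.Hm V, HodgeCM.HermSpace3.isHermitian V,
            HodgeCM.HermSpace3.signature_ι₁ V, HodgeCM.HermSpace3.posDef_of_ne V⟩ Φ)).G ≃ₜ*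
        ↥(finAdelic ↥(maximalRealSubfield (F : Type)) (F : Type) (IsCMField.complexConj (F : Type)) 2 Jstar))
      (_ : ∀ u, φGS (F : Type) Jstar Jperp (HodgeCM.HermSpace3.Hm V) B one_ne_zero hB (eG.symm u) =
        finAdelicCongr ↥(maximalRealSubfield (F : Type)) (F : Type) (IsCMField.complexConj (F : Type)) B one_ne_zero hB
          (finAdelicBlockDiag ↥(maximalRealSubfield (F : Type)) (F : Type) (IsCMField.complexConj (F : Type)) 2 1 Jstar Jperp (u, 1))),
      Pin (sec42DataGS (F := ⟨HodgeCM.CMField.K F⟩) S (le_trans (Nat.le_of_ble_eq_true rfl) h6)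
          (Model.isoOf ⟨HodgeCM.CMField.K F⟩ ι₁ ⟨HodgeCM.HermSpace3.Hm V, HodgeCM.HermSpace3.isHermitian V,
            HodgeCM.HermSpace3.signature_ι₁ V, HodgeCM.HermSpace3.posDef_of_ne V⟩ Φ))
        (φGS (F : Type) Jstar Jperp (HodgeCM.HermSpace3.Hm V) B one_ne_zero hB)) :
    ∀ X : (sec42DataOfFourLe (Summit.HodgeConjecture.CorCM.DelRec.exists_recordSystem_of_printed hDel)
        (⟨HodgeCM.HermSpace3.Hm V, HodgeCM.HermSpace3.isHermitian V, HodgeCM.HermSpace3.signature_ι₁ V, HodgeCM.HermSpace3.posDef_of_ne V⟩ :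
          HermSpace3 (⟨HodgeCM.CMField.K F⟩ : CMField) ι₁) Φ (le_trans (Nat.le_of_ble_eq_true rfl) h6)
        (Model.isoOf ⟨HodgeCM.CMField.K F⟩ ι₁ ⟨HodgeCM.HermSpace3.Hm V, HodgeCM.HermSpace3.isHermitian V,
          HodgeCM.HermSpace3.signature_ι₁ V, HodgeCM.HermSpace3.posDef_of_ne V⟩ Φ)).EtaleHeckeDatum ℓ,
      X.IsInducedBy (sec42DataOfFourLe_heckeTranslates heckeTranslate_definedOver_holds
          (Summit.HodgeConjecture.CorCM.DelRec.exists_recordSystem_of_printed hDel)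
          (⟨HodgeCM.HermSpace3.Hm V, HodgeCM.HermSpace3.isHermitian V, HodgeCM.HermSpace3.signature_ι₁ V, HodgeCM.HermSpace3.posDef_of_ne V⟩ :
            HermSpace3 (⟨HodgeCM.CMField.K F⟩ : CMField) ι₁) Φ (le_trans (Nat.le_of_ble_eq_true rfl) h6)
          (Model.isoOf ⟨HodgeCM.CMField.K F⟩ ι₁ ⟨HodgeCM.HermSpace3.Hm V, HodgeCM.HermSpace3.isHermitian V,
            HodgeCM.HermSpace3.signature_ι₁ V, HodgeCM.HermSpace3.posDef_of_ne V⟩ Φ)) →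
      S34SomeSource
        (sec42DataOfFourLe (Summit.HodgeConjecture.CorCM.DelRec.exists_recordSystem_of_printed hDel)
          (⟨HodgeCM.HermSpace3.Hm V, HodgeCM.HermSpace3.isHermitian V, HodgeCM.HermSpace3.signature_ι₁ V, HodgeCM.HermSpace3.posDef_of_ne V⟩ :
            HermSpace3 (⟨HodgeCM.CMField.K F⟩ : CMField) ι₁) Φ (le_trans (Nat.le_of_ble_eq_true rfl) h6)
          (Model.isoOf ⟨HodgeCM.CMField.K F⟩ ι₁ ⟨HodgeCM.HermSpace3.Hm V, HodgeCM.HermSpace3.isHermitian V,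
            HodgeCM.HermSpace3.signature_ι₁ V, HodgeCM.HermSpace3.posDef_of_ne V⟩ Φ))
        ({ Eps := (UV hDel F V a Φ).Eps, epsOf := (UV hDel F V a Φ).epsOf, Chi := (UV hDel F V a Φ).Chi,
           omega := (UV hDel F V a Φ).omega, rho := (UV hDel F V a Φ).rho } :
          UniformOmega (sec42DataOfFourLe (Summit.HodgeConjecture.CorCM.DelRec.exists_recordSystem_of_printed hDel)
            (⟨HodgeCM.HermSpace3.Hm V, HodgeCM.HermSpace3.isHermitian V, HodgeCM.HermSpace3.signature_ι₁ V, HodgeCM.HermSpace3.posDef_of_ne V⟩ :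
              HermSpace3 (⟨HodgeCM.CMField.K F⟩ : CMField) ι₁) Φ (le_trans (Nat.le_of_ble_eq_true rfl) h6)
            (Model.isoOf ⟨HodgeCM.CMField.K F⟩ ι₁ ⟨HodgeCM.HermSpace3.Hm V, HodgeCM.HermSpace3.isHermitian V,
              HodgeCM.HermSpace3.signature_ι₁ V, HodgeCM.HermSpace3.posDef_of_ne V⟩ Φ)))
        ℓ X ι' ν hν
        (sec42DataOfFourLe_heckeTranslates heckeTranslate_definedOver_holds
          (Summit.HodgeConjecture.CorCM.DelRec.exists_recordSystem_of_printed hDel)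
          (⟨HodgeCM.HermSpace3.Hm V, HodgeCM.HermSpace3.isHermitian V, HodgeCM.HermSpace3.signature_ι₁ V, HodgeCM.HermSpace3.posDef_of_ne V⟩ :
            HermSpace3 (⟨HodgeCM.CMField.K F⟩ : CMField) ι₁) Φ (le_trans (Nat.le_of_ble_eq_true rfl) h6)
          (Model.isoOf ⟨HodgeCM.CMField.K F⟩ ι₁ ⟨HodgeCM.HermSpace3.Hm V, HodgeCM.HermSpace3.isHermitian V,
            HodgeCM.HermSpace3.signature_ι₁ V, HodgeCM.HermSpace3.posDef_of_ne V⟩ Φ))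
        Pin := by
  intro X hX _h3 _hw1 ε hε χ f hf hf0
  -- the face's Betti pinning along `conj ∘ ι₁` at the explicit carrier (F3b ★)
  -- (`∃`/`Nonempty` facts are BOUND by `have` before `obtain` destructures them: on an application `rcases` generalises the
  -- term over the unfolded `S34SomeSource` goal, ≈ 1.2 M heartbeats a site — ED-GS8-HB edition 2, A-p18)
  have hBpin := nonempty_bettiPinning_conj_fourLe_of_lemma24Proj hDel F h6 V a Φ
  obtain ⟨Bpin⟩ := hBpin
  -- CLAUSE (1): the GS seesaw source detecting `f` (v20 head of ★ `A3Liu418S34ClauseOneOfCurveRecords`), with the registry's pin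
  -- feeder evaluated at `eG := refl`, `φ_pin := rfl`
  have hsrc := exists_seesawSourceGS_etPull_comp_ne_zero' hMR heckeTranslate_definedOver_holds
      (Summit.HodgeConjecture.CorCM.DelRec.exists_recordSystem_of_printed hDel)
      (⟨HodgeCM.HermSpace3.Hm V, HodgeCM.HermSpace3.isHermitian V, HodgeCM.HermSpace3.signature_ι₁ V, HodgeCM.HermSpace3.posDef_of_ne V⟩ :
        HermSpace3 (⟨HodgeCM.CMField.K F⟩ : CMField) ι₁) Φ (le_trans (Nat.le_of_ble_eq_true rfl) h6)
      (Model.isoOf ⟨HodgeCM.CMField.K F⟩ ι₁ ⟨HodgeCM.HermSpace3.Hm V, HodgeCM.HermSpace3.isHermitian V,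
        HodgeCM.HermSpace3.signature_ι₁ V, HodgeCM.HermSpace3.posDef_of_ne V⟩ Φ)
      (Model.isoOf ⟨HodgeCM.CMField.K F⟩ ι₁ ⟨HodgeCM.HermSpace3.Hm V, HodgeCM.HermSpace3.isHermitian V,
        HodgeCM.HermSpace3.signature_ι₁ V, HodgeCM.HermSpace3.posDef_of_ne V⟩ Φ)
      X ι' hX Bpin ((UV hDel F V a Φ).rho ν hν ε χ) f hf hf0 Pin
      (fun Jstar Jperp B hB hpos {K₀} S => mkPin Jstar Jperp B hB hpos S (ContinuousMulEquiv.refl _) (fun _ => rfl))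
  obtain ⟨Jstar, Jperp, B, hB, hpos, K₀, S, hU7ₛ, hEmb, hLQ, hK₀, hne⟩ := hsrc
  refine ⟨_, hne, ?_⟩
  -- CLAUSE (2): the named fact GS-6 at the curve's own §4.2 datum (`frobeniusActsBy_seesawSourceGS_iff` is `Iff.rfl`)
  rw [frobeniusActsBy_seesawSourceGS_iff]
  exact hGS6 hDel F V a Φ hΦ ν hν hw ℓ ι' Jstar K₀ S hU7ₛ hLQ _ _ Jperp B 1 one_ne_zero hB
    (by rw [map_one, Complex.one_re]; exact one_pos) (by rw [map_one, Complex.one_im]) ε hε χ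

/-- **(H2) `S34SomeSource` AT THE FACE FROM THE GS SEESAW SOURCE — the GS-8 head the v18 registry's `stub_S34` fill consumes** (signature of
record, A-p18 8d87338b): (H1) `s34SomeSource_fourLe_of_GS` transported ONCE from the explicit carrier `(C₄, U₄, T₄)` to the face's total carrier
`(CV, UV, TV)` by F4 ★ `S34SomeSource.forall_transport` along ★ `sec42DataOf_eq_of_four_le` (`dif_pos`), ★ `UniformOmega.heq_mk_of_eq`,
★ `sec42DataOf_heckeTranslates_heq`, `HEq.rfl` for `Pin` (`Sec42Data.G` is `P5.G` by `rfl`).  HC_CM is NOT proved; `hMR` (III-8′),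
`hGS6` ([Liu2021] Thm. D.6 (1)), `hDel` are hypotheses (v20: `hGS3` dropped — GS-3 retired by road (ii)).
[cite: Liu2021, Thm. 4.15 proof p. 51 (FJcycle.tex l. 2185–2213) with fn. 9; App. D Thm. D.6 (1) p. 132, Rem. D.5 p. 131; §4.2 l. 2053–2081]
[cite: Deligne1979ShimuraVarieties, Thm. 2.7.20, Cor. 2.7.21] [cite: Milne2005ShimuraVarieties, Thm. 13.6 p. 118, Thm. 13.7 p. 119] -/
theorem s34SomeSource_CV_of_GS'
    (hMR : ∀ {X : Literature.AlgebraicGeometry.Motives.SchemeOver ℂ}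
      (D : Literature.AlgebraicGeometry.ShimuraVarieties.UnitaryBallUniformisationDatum 2 X), D.MR92Prop6Source)
    (hGS6 : frobeniusActsByGS)
    (hDel : Literature.AlgebraicGeometry.ShimuraVarieties.UnitaryCanonicalModel.canonicalModel_exists_printed)
    (F : HodgeCM.CMField) [IsGalois ℚ F] (h6 : 6 ≤ Module.finrank ℚ F) {ι₁ : F →+* ℂ} (V : HodgeCM.HermSpace3 F ι₁)
    (a : HodgeCM.Model.LiuIndex.RealScalar F) (Φ : CMType F) (hΦ : ι₁ ∈ Φ.1)
    (ν : Literature.NumberTheory.Automorphic.IdeleClassGroup (F : Type) →ₜ* Circle)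
    (hν : IdeleClassGroup.IsConjugateSymplectic (F : Type) ν) (hw : IdeleClassGroup.HasWeight (F : Type) ν 1)
    (ℓ : ℕ) [Fact ℓ.Prime] (X : (CV hDel F V Φ).EtaleHeckeDatum ℓ) (ι' : ℂ ≃+* AlgebraicClosure ℚ_[ℓ])
    (hX : X.IsInducedBy (TV hDel F h6 V Φ))
    (Pin : ∀ {P5ₛ : PropC5Data ↥(maximalRealSubfield (F : Type)) (F : Type)} {isoₛ : ℕ → Prop} (Cₛ : Sec42Data P5ₛ isoₛ),
      (Cₛ.G →* (CV hDel F V Φ).G) → Prop)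
    (mkPin : ∀ (Jstar : Matrix (Fin 2) (Fin 2) (F : Type)) (Jperp : Matrix (Fin 1) (Fin 1) (F : Type)) (B : GL (Fin 3) (F : Type))
      (hB : formCongr ((IsCMField.complexConj (F : Type) : (F : Type) ≃ₐ[↥(maximalRealSubfield (F : Type))] (F : Type)) :
          (F : Type) →+* (F : Type)) B ((1 : (F : Type)) • HodgeCM.HermSpace3.Hm V) = finSum 2 1 Jstar Jperp)
      (_ : ∀ τ : (F : Type) →+* ℂ, 0 < (τ (Jperp 0 0)).re)
      {K₀ : C5.OpenCompactSubgroup ↥(finAdelic ↥(maximalRealSubfield (F : Type)) (F : Type) (IsCMField.complexConj (F : Type)) 2 Jstar)}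
      (S : RecordSystemGS (F : Type) Jstar ι₁ K₀)
      (eG : (sec42DataGS (F := ⟨HodgeCM.CMField.K F⟩) S (le_trans (Nat.le_of_ble_eq_true rfl) h6)
          (Model.isoOf ⟨HodgeCM.CMField.K F⟩ ι₁ ⟨HodgeCM.HermSpace3.Hm V, HodgeCM.HermSpace3.isHermitian V,
            HodgeCM.HermSpace3.signature_ι₁ V, HodgeCM.HermSpace3.posDef_of_ne V⟩ Φ)).G ≃ₜ*
        ↥(finAdelic ↥(maximalRealSubfield (F : Type)) (F : Type) (IsCMField.complexConj (F : Type)) 2 Jstar))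
      (_ : ∀ u, φGS (F : Type) Jstar Jperp (HodgeCM.HermSpace3.Hm V) B one_ne_zero hB (eG.symm u) =
        finAdelicCongr ↥(maximalRealSubfield (F : Type)) (F : Type) (IsCMField.complexConj (F : Type)) B one_ne_zero hB
          (finAdelicBlockDiag ↥(maximalRealSubfield (F : Type)) (F : Type) (IsCMField.complexConj (F : Type)) 2 1 Jstar Jperp (u, 1))),
      Pin (sec42DataGS (F := ⟨HodgeCM.CMField.K F⟩) S (le_trans (Nat.le_of_ble_eq_true rfl) h6)
          (Model.isoOf ⟨HodgeCM.CMField.K F⟩ ι₁ ⟨HodgeCM.HermSpace3.Hm V, HodgeCM.HermSpace3.isHermitian V,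
            HodgeCM.HermSpace3.signature_ι₁ V, HodgeCM.HermSpace3.posDef_of_ne V⟩ Φ))
        (φGS (F : Type) Jstar Jperp (HodgeCM.HermSpace3.Hm V) B one_ne_zero hB)) :
    S34SomeSource (CV hDel F V Φ) (UV hDel F V a Φ) ℓ X ι' ν hν (TV hDel F h6 V Φ) Pin := by
  refine S34SomeSource.forall_transport
    (sec42DataOf_eq_of_four_le (Summit.HodgeConjecture.CorCM.DelRec.exists_recordSystem_of_printed hDel)
      (⟨HodgeCM.HermSpace3.Hm V, HodgeCM.HermSpace3.isHermitian V, HodgeCM.HermSpace3.signature_ι₁ V, HodgeCM.HermSpace3.posDef_of_ne V⟩ :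
        HermSpace3 (⟨HodgeCM.CMField.K F⟩ : CMField) ι₁) Φ Model.isoOf (le_trans (Nat.le_of_ble_eq_true rfl) h6)).symm
    (UniformOmega.heq_mk_of_eq
      (sec42DataOf_eq_of_four_le (Summit.HodgeConjecture.CorCM.DelRec.exists_recordSystem_of_printed hDel)
        (⟨HodgeCM.HermSpace3.Hm V, HodgeCM.HermSpace3.isHermitian V, HodgeCM.HermSpace3.signature_ι₁ V, HodgeCM.HermSpace3.posDef_of_ne V⟩ :
          HermSpace3 (⟨HodgeCM.CMField.K F⟩ : CMField) ι₁) Φ Model.isoOf (le_trans (Nat.le_of_ble_eq_true rfl) h6))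
      (UV hDel F V a Φ))
    ι' ν hν
    (sec42DataOf_heckeTranslates_heq heckeTranslate_definedOver_holds
      (Summit.HodgeConjecture.CorCM.DelRec.exists_recordSystem_of_printed hDel)
      (⟨HodgeCM.HermSpace3.Hm V, HodgeCM.HermSpace3.isHermitian V, HodgeCM.HermSpace3.signature_ι₁ V, HodgeCM.HermSpace3.posDef_of_ne V⟩ :
        HermSpace3 (⟨HodgeCM.CMField.K F⟩ : CMField) ι₁) Φ Model.isoOf (le_trans (Nat.le_of_ble_eq_true rfl) h6)).symm
    (Pin := Pin) HEq.rfl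
    (s34SomeSource_fourLe_of_GS' hMR hGS6 hDel F h6 V a Φ hΦ ν hν hw ℓ ι' Pin mkPin) X hX

end HeadsV20

end Summit.HodgeConjecture.CorCM.Lines.A3Liu418

end
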